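import Summits.QuantumFields.BalabanUV.T4Continuum.Support.OutputRateOpGaussianParam

/-!
# OutputRateGaussianParamBi — ONE dictionary shape for (2.14)-shaped terms serving BOTH input species: the parametrised
# complex-Gaussian term with an EXP-LINEAR insertion `F₀(p,v)·exp(Λ(p,v)·h)` ⟹ `TermOpGaussianParam` (operator species) AND
# `TermHistExpLinear` (history species) ⟹ the END face with NO analyticity binder on either species
# (cell `pub-balaban`, T⁴ fan-out, `HOME/BINDER-OWNERS.md` row NE5, owner lineage t4-ne5-p1, gen 29, route P1)

HONEST FRAMING (T4-DAG PAGE 1).  Rung (B)+1 on ONE finite four-torus of fixed physical size — NOT infinite volume, NOT a mass gap, NOT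
the Clay problem; `FlowStep.BetaPertH`, (B), (B^μ) do not occur here.  NE5 (`T4OutputRate.NE5`) is NOT PRINTED and NOT PROVED (spine
0/9, unchanged).  Nothing of Bałaban's series is asserted; 0 cite tags.  The located print (quoted verbatim in the lineage's loci sheet
`b13-loci.md` and the leaf `T4InputCauchyRateData` §11): [II] = [Balaban1988RG2Cluster] p. 15 (2.14) — in ONE resummed term the earlier
actions enter ONLY through the last factor `exp[Σ_{Y∈𝐃} τ(Y)𝐕_k(Y,B)]` (linear in the inserted potentials, p. 9 (1.33)), the operators
through the Gaussian data at `(Z₀, σ(Z))` and the normalisations, the contour/interpolation parameters `(s, σ, t, τ)` are integrated outside.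
HONEST DEPENDENCY (cell, verbatim): continuum YM on T⁴ ⇐ BetaPertH ∧ nine spine estimates (0/9 proved); BetaPertH ⇐ (D1) ∧ (D4) ∧ CAP+tail;
G-an2-4 gates asym, D1 and NE2/3/4.

WHAT THIS MODULE IS.  The operator half of W2 has the producer `OutputRateOpGaussianParam.termOpHolomorphicBall_of_gaussianParam`
(p214635), the history half the leaf's `termHistLineAnalytic_of_expLinear` from `TermHistExpLinear` (`T4InputCauchyRateTermwise` v1.2).
For a (2.14)-shaped term the two dictionaries are ONE: the insertion is `gIns(h)(p, v) = F₀(p, v)·exp(Λ(p, v)·h)` with a bounded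
potential-free factor `F₀` (characteristic functions) and a bounded continuous-linear read-out `Λ(p, v) : Hist →L[ℂ] ℂ` of the history
(`h ↦ Σ τ(Y)𝐕_k(Y, v; h)`).  Here:
* §1 `norm_mul_cexp_clm_le` — growth of the exp-linear insertion: `‖F₀·exp(Λ h)‖ ≤ F·e^{N₁‖h‖}` (`‖F₀‖ ≤ F`, `‖Λ‖ ≤ N₁`), hence
  `≤ (F e^{N₁‖h‖})·e^{(m/2)‖v‖²}`; its joint measurability.
* §2 the shape **`TermGaussianParamBi T W ctr RHist R′ lam w N F₀ Λ q m b w₀ N₀ F N₁`** (data indexed by `(k, i, X)` and the integration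
  variables — NOT by the history datum; [analysis]/dictionary, asserted nowhere) and the two producers
  **`termOpGaussianParam_of_bi`** (⟹ `TermOpGaussianParam` with `gIns k i h X p v = F₀ p v·exp(Λ p v h)`, `G₀ = F·e^{N₁‖h‖}`) and
  **`termHistExpLinear_of_bi`** (⟹ `TermHistExpLinear (ballClass ctr ROp RHist)` with reference measure `lam ⊗ vol`, density
  `Φ(o)(p,v) = w(p)N(o,p)F₀(p,v)e^{−q(o,p,v)}`, read-out `Λ`; integrability from the Gaussian majorant, the representation by the Fubini
  lemma `integral_paramIntegrand_prod` of p214635 — room `ROp k < R′ k`).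
* §3 END face **`ne5_at_of_stepModel_termwise_gaussianParamBi_budget_scale_nat`** — the bi-structural budgeted END of
  `OutputRateOpHolomorphic` with BOTH structural binders (`hball`, `hexp`) PRODUCED from the ONE shape; every other binder BY NAME
  (MI-R, budget, `TermRep`/`TermBound`/`TermBudget`, one-run levels, W1, W4, insertion structure, W3, R, S); SAME smallness
  `ω + G·c/(1 − ρ₀) < θ′`, SAME constant; conclusion `T4OutputRate.NE5` LITERALLY.

STATUS (census, Edison rule).  For (2.14)-shaped terms W2 (both species) is now ONE dictionary + letters: exhibit the model-of-record term
as `TermGaussianParamBi` (the swarm's O1-d2-ii: parameter spaces, Cauchy weights `w₀`, normalisations `N₀`, characteristic-function factor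
`F`, the history read-out with `‖Λ‖ ≤ N₁` = the `Σ|τ(Y)|×`(1.36)-budget letter, the exponent with its margin `m₂ + m₁R′ < m₀` via
`OutputRateOpGaussianParamMargin`).  No wall is discharged from print; W2 CONSTANT-only on the operator side, the history modulus enters S as
before; NE5 NOT PROVED; 0/12 leaves on Bałaban's concrete objects; spine 0/9; rung (B)+1 finite T⁴; NOT infinite volume / mass gap / Clay.
0 sorry; axioms ⊆ {propext, Classical.choice, Quot.sound}.
-/

noncomputable section

open Set Metric MeasureTheory Filter

namespace Summit.QuantumFields.BalabanUV.T4Continuum.OutputRateGaussianParamBi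

open Literature.MathematicalPhysics.QuantumFieldTheory.Balaban1983to89
open Literature.MathematicalPhysics.QuantumFieldTheory.Balaban1983to89.T4OutputRate
open Literature.MathematicalPhysics.QuantumFieldTheory.Balaban1983to89.T4InputCauchyRate
open Literature.MathematicalPhysics.QuantumFieldTheory.Balaban1983to89.T4InputCauchyRateData
open Literature.MathematicalPhysics.QuantumFieldTheory.Balaban1983to89.T4InputCauchyRateSpecies
open Literature.MathematicalPhysics.QuantumFieldTheory.Balaban1983to89.T4InputCauchyRateTermwise
open Summit.QuantumFields.BalabanUV.T4Continuum.OutputRateOpHolomorphic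
open Summit.QuantumFields.BalabanUV.T4Continuum.OutputRateOpGaussian
open Summit.QuantumFields.BalabanUV.T4Continuum.OutputRateOpGaussianParam

/-! ## §1 The exp-linear insertion: growth and joint measurability -/

section Insertion

variable {P V Hist : Type*} [NormedAddCommGroup Hist] [NormedSpace ℂ Hist]

/-- **GROWTH OF THE EXP-LINEAR INSERTION**: `‖F₀·exp(Λ h)‖ ≤ F·e^{N₁‖h‖}` when `‖F₀‖ ≤ F` and `‖Λ‖ ≤ N₁`. [folklore] -/
theorem norm_mul_cexp_clm_le {F₀ : ℂ} {Λ : Hist →L[ℂ] ℂ} {F N₁ : ℝ} (hF : ‖F₀‖ ≤ F) (hΛ : ‖Λ‖ ≤ N₁) (h : Hist) :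
    ‖F₀ * Complex.exp (Λ h)‖ ≤ F * Real.exp (N₁ * ‖h‖) := by
  have hF0 : 0 ≤ F := (norm_nonneg _).trans hF
  rw [norm_mul, Complex.norm_exp]
  refine mul_le_mul hF (Real.exp_le_exp.2 ?_) (Real.exp_pos _).le hF0
  exact (Complex.re_le_norm _).trans ((Λ.le_opNorm h).trans (mul_le_mul_of_nonneg_right hΛ (norm_nonneg _)))

/-- … hence the GROWTH CLAUSE of the Gaussian hooks with `G₀ = F·e^{N₁‖h‖}` and any `m`-rate (`e^{(m/2)‖v‖²} ≥ 1` for `m ≥ 0`). [folklore] -/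
theorem norm_mul_cexp_clm_le_growth [NormedAddCommGroup V] {F₀ : P → V → ℂ} {Λ : P → V → (Hist →L[ℂ] ℂ)} {F N₁ m : ℝ}
    (hm : 0 ≤ m) (hF : ∀ p v, ‖F₀ p v‖ ≤ F) (hΛ : ∀ p v, ‖Λ p v‖ ≤ N₁) (h : Hist) (p : P) (v : V) :
    ‖F₀ p v * Complex.exp (Λ p v h)‖ ≤ F * Real.exp (N₁ * ‖h‖) * Real.exp (m / 2 * ‖v‖ ^ 2) := by
  have h1 := norm_mul_cexp_clm_le (hF p v) (hΛ p v) h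
  have hF0 : 0 ≤ F := (norm_nonneg _).trans (hF p v)
  calc ‖F₀ p v * Complex.exp (Λ p v h)‖ ≤ F * Real.exp (N₁ * ‖h‖) * 1 := by rw [mul_one]; exact h1
    _ ≤ F * Real.exp (N₁ * ‖h‖) * Real.exp (m / 2 * ‖v‖ ^ 2) :=
        mul_le_mul_of_nonneg_left (Real.one_le_exp (by positivity)) (mul_nonneg hF0 (Real.exp_pos _).le)

variable [MeasurableSpace P] [MeasurableSpace V]

/-- joint measurability of the exp-linear insertion at a fixed history datum. [folklore] -/
theorem aestronglyMeasurable_mul_cexp_clm {μ : Measure (P × V)} {F₀ : P → V → ℂ} {Λ : P → V → (Hist →L[ℂ] ℂ)}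
    (hF₀ : AEStronglyMeasurable (Function.uncurry F₀) μ)
    (hΛ : ∀ y : Hist, AEStronglyMeasurable (fun z : P × V => Λ z.1 z.2 y) μ) (h : Hist) :
    AEStronglyMeasurable (Function.uncurry fun p v => F₀ p v * Complex.exp (Λ p v h)) μ :=
  hF₀.mul (Complex.continuous_exp.comp_aestronglyMeasurable (hΛ h))

end Insertion

/-! ## §2 The one shape and its two producers -/

section Shape

variable {C : Carriers} {Op Hist : Type*} [NormedAddCommGroup Op] [NormedSpace ℂ Op] [NormedAddCommGroup Hist]
  [NormedSpace ℂ Hist] {ι : Type*} (T : ℕ → ι → Op → Hist → C.Dom → ℂ)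
  {β : ℕ → ι → Type*} [∀ k i, MeasurableSpace (β k i)]
  {α : ℕ → ι → Type*} [∀ k i, NormedAddCommGroup (α k i)] [∀ k i, InnerProductSpace ℝ (α k i)]
  [∀ k i, FiniteDimensional ℝ (α k i)] [∀ k i, MeasurableSpace (α k i)] [∀ k i, BorelSpace (α k i)]

/-- HYPOTHESIS SHAPE `TermGaussianParamBi T W ctr RHist R′ lam w N F₀ Λ q m b w₀ N₀ F N₁` ([analysis]/dictionary for ONE resummed term
of (2.14), BOTH species at once; asserted nowhere).  Per step `k`, window point, background, step-`k` domain `X` and term index `i` — with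
data depending on `(k, i, X)` and the integration variables ONLY (not on the history datum): parameter space `β k i` with FINITE measure
`lam k i X`; margin `m > 0`; Cauchy weight `w` (a.e.-strongly measurable, `‖w p‖ ≤ w₀`); on the open operator ball of radius `R′ k` around
the class centre a normalisation prefactor `N(o, ·)` (a.e.-strongly measurable, `‖N‖ ≤ N₀`, `N(·, p)` holomorphic); a potential-free factor
`F₀` (jointly a.e.-strongly measurable on `β × α`, `‖F₀‖ ≤ F`); a history read-out `Λ p v : Hist →L[ℂ] ℂ` (`(p, v) ↦ Λ p v y` jointly
a.e.-strongly measurable for every `y`, `‖Λ p v‖ ≤ N₁`, `0 ≤ N₁`); an exponent `q(o, ·, ·)` (jointly a.e.-strongly measurable, `q(·, p, v)`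
holomorphic on the ball, AFFINE margin `Re q ≥ m‖v‖² − b` on the ball); and, for `o` in the ball and `h` in the class's history ball, the
ITERATED representation `T k i o h X = ∫ w(p)N(o,p) (∫ F₀(p,v)e^{Λ(p,v)h}·e^{−q(o,p,v)} dv) dλ(p)`. [folklore] -/
def TermGaussianParamBi (W : Set (ℕ → ℝ)) (ctr : ℕ → (ℕ → ℝ) → C.BgB → Op × Hist) (RHist R' : ℕ → ℝ)
    (lam : ∀ k i, C.Dom → Measure (β k i)) (w : ∀ k i, C.Dom → β k i → ℂ) (N : ∀ k i, C.Dom → Op → β k i → ℂ)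
    (F₀ : ∀ k i, C.Dom → β k i → α k i → ℂ) (Λ : ∀ k i, C.Dom → β k i → α k i → (Hist →L[ℂ] ℂ))
    (q : ∀ k i, C.Dom → Op → β k i → α k i → ℂ) (m b w₀ N₀ F N₁ : ℕ → ι → C.Dom → ℝ) : Prop :=
  ∀ k, ∀ g ∈ W, ∀ (U : C.BgB) (X : C.Dom), C.scale X = k → ∀ i,
    IsFiniteMeasure (lam k i X) ∧ 0 < m k i X ∧
    AEStronglyMeasurable (w k i X) (lam k i X) ∧ (∀ p, ‖w k i X p‖ ≤ w₀ k i X) ∧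
    (∀ o ∈ ball (ctr k g U).1 (R' k), AEStronglyMeasurable (N k i X o) (lam k i X)) ∧
    (∀ p, DifferentiableOn ℂ (fun o => N k i X o p) (ball (ctr k g U).1 (R' k))) ∧
    (∀ o ∈ ball (ctr k g U).1 (R' k), ∀ p, ‖N k i X o p‖ ≤ N₀ k i X) ∧
    AEStronglyMeasurable (Function.uncurry (F₀ k i X)) ((lam k i X).prod volume) ∧ (∀ p v, ‖F₀ k i X p v‖ ≤ F k i X) ∧
    (∀ y : Hist, AEStronglyMeasurable (fun z : β k i × α k i => Λ k i X z.1 z.2 y) ((lam k i X).prod volume)) ∧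
    (∀ p v, ‖Λ k i X p v‖ ≤ N₁ k i X) ∧ 0 ≤ N₁ k i X ∧
    (∀ o ∈ ball (ctr k g U).1 (R' k), AEStronglyMeasurable (Function.uncurry (q k i X o)) ((lam k i X).prod volume)) ∧
    (∀ p v, DifferentiableOn ℂ (fun o => q k i X o p v) (ball (ctr k g U).1 (R' k))) ∧
    (∀ o ∈ ball (ctr k g U).1 (R' k), ∀ p v, m k i X * ‖v‖ ^ 2 - b k i X ≤ (q k i X o p v).re) ∧
    (∀ o ∈ ball (ctr k g U).1 (R' k), ∀ h ∈ closedBall (ctr k g U).2 (RHist k), T k i o h X =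
      ∫ p, w k i X p * N k i X o p *
        ∫ v, F₀ k i X p v * Complex.exp (Λ k i X p v h) * Complex.exp (-q k i X o p v) ∂volume ∂(lam k i X))

variable {T}

/-- **PRODUCER 1 (operator species)**: `TermGaussianParamBi ⟹ TermOpGaussianParam` with the exp-linear insertion
`gIns k i h X p v = F₀ p v·exp(Λ p v h)` and growth constant `G₀ k i h X = F·e^{N₁‖h‖}` (§1). [folklore] -/
theorem termOpGaussianParam_of_bi {W : Set (ℕ → ℝ)} {ctr : ℕ → (ℕ → ℝ) → C.BgB → Op × Hist} {RHist R' : ℕ → ℝ}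
    {lam : ∀ k i, C.Dom → Measure (β k i)} {w : ∀ k i, C.Dom → β k i → ℂ} {N : ∀ k i, C.Dom → Op → β k i → ℂ}
    {F₀ : ∀ k i, C.Dom → β k i → α k i → ℂ} {Λ : ∀ k i, C.Dom → β k i → α k i → (Hist →L[ℂ] ℂ)}
    {q : ∀ k i, C.Dom → Op → β k i → α k i → ℂ} {m b w₀ N₀ F N₁ : ℕ → ι → C.Dom → ℝ}
    (hBi : TermGaussianParamBi T W ctr RHist R' lam w N F₀ Λ q m b w₀ N₀ F N₁) :
    TermOpGaussianParam T W ctr RHist R' (fun k i _ X => lam k i X) (fun k i _ X => w k i X) (fun k i _ X => N k i X)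
      (fun k i h X p v => F₀ k i X p v * Complex.exp (Λ k i X p v h)) (fun k i _ X => q k i X) (fun k i _ X => m k i X)
      (fun k i _ X => b k i X) (fun k i _ X => w₀ k i X) (fun k i _ X => N₀ k i X)
      fun k i h X => F k i X * Real.exp (N₁ k i X * ‖h‖) := by
  intro k g hg U h hh X hX i
  obtain ⟨hfin, hm, hwm, hwb, hNm, hNh, hNb, hF₀m, hF₀b, hΛm, hΛb, -, hqm, hqh, hqre, hrepr⟩ := hBi k g hg U X hX i
  exact ⟨hfin, hm, hwm, hwb, hNm, hNh, hNb, aestronglyMeasurable_mul_cexp_clm hF₀m hΛm h,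
    norm_mul_cexp_clm_le_growth hm.le hF₀b hΛb h, hqm, hqh, hqre, fun o ho => hrepr o ho h hh⟩

/-- **PRODUCER 2 (history species)**: with room `ROp k < R′ k`, `TermGaussianParamBi ⟹ TermHistExpLinear (ballClass ctr ROp RHist)`
with reference measures `lam k i X ⊗ vol` on `β k i × α k i`, densities `Φ(o)(p, v) = w(p)N(o,p)F₀(p,v)e^{−q(o,p,v)}` (integrable: the
Gaussian majorant of `OutputRateOpGaussianParam`) and read-outs `Λ` — the representation by Fubini (`integral_paramIntegrand_prod`).
[folklore] -/
theorem termHistExpLinear_of_bi {W : Set (ℕ → ℝ)} {ctr : ℕ → (ℕ → ℝ) → C.BgB → Op × Hist} {ROp RHist R' : ℕ → ℝ}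
    {lam : ∀ k i, C.Dom → Measure (β k i)} {w : ∀ k i, C.Dom → β k i → ℂ} {N : ∀ k i, C.Dom → Op → β k i → ℂ}
    {F₀ : ∀ k i, C.Dom → β k i → α k i → ℂ} {Λ : ∀ k i, C.Dom → β k i → α k i → (Hist →L[ℂ] ℂ)}
    {q : ∀ k i, C.Dom → Op → β k i → α k i → ℂ} {m b w₀ N₀ F N₁ : ℕ → ι → C.Dom → ℝ} (hroom : ∀ k, ROp k < R' k)
    (hBi : TermGaussianParamBi T W ctr RHist R' lam w N F₀ Λ q m b w₀ N₀ F N₁) :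
    TermHistExpLinear (ballClass ctr ROp RHist) T W (fun k i (_ : Op) X => (lam k i X).prod (volume : Measure (α k i)))
      (fun k i o X z => w k i X z.1 * N k i X o z.1 * (F₀ k i X z.1 z.2 * Complex.exp (-q k i X o z.1 z.2)))
      fun k i _ X z => Λ k i X z.1 z.2 := by
  intro k g hg U p hp X hX i
  obtain ⟨hfin, hm, hwm, hwb, hNm, hNh, hNb, hF₀m, hF₀b, hΛm, hΛb, hN₁, hqm, hqh, hqre, hrepr⟩ := hBi k g hg U X hX i
  haveI := hfin
  have hp' := Set.mem_prod.1 hp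
  have ho : p.1 ∈ ball (ctr k g U).1 (R' k) := mem_ball.2 (lt_of_le_of_lt (mem_closedBall.1 hp'.1) (hroom k))
  -- growth of the potential-free factor alone (rate `m/2`, constant `F`)
  have hF₀g : ∀ a v, ‖F₀ k i X a v‖ ≤ F k i X * Real.exp (m k i X / 2 * ‖v‖ ^ 2) := fun a v => by
    have hF0 : 0 ≤ F k i X := (norm_nonneg _).trans (hF₀b a v)
    calc ‖F₀ k i X a v‖ ≤ F k i X * 1 := by rw [mul_one]; exact hF₀b a v
      _ ≤ F k i X * Real.exp (m k i X / 2 * ‖v‖ ^ 2) :=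
          mul_le_mul_of_nonneg_left (Real.one_le_exp (by positivity [hm.le])) hF0
  refine ⟨integrable_paramIntegrand hm hwm hwb hNm hNh hNb hF₀m hF₀g hqm hqh hqre ho,
    fun y => hΛm y, ⟨N₁ k i X, Eventually.of_forall fun z => hΛb z.1 z.2⟩, ?_⟩
  -- representation: iterated (shape) ⟹ product (Fubini of p214635 with the exp-linear insertion) ⟹ regrouped
  have hgm := aestronglyMeasurable_mul_cexp_clm hF₀m hΛm p.2
  have hgg := norm_mul_cexp_clm_le_growth (m := m k i X) hm.le hF₀b hΛb p.2
  rw [hrepr p.1 ho p.2 hp'.2, ← integral_paramIntegrand_prod hm hwm hwb hNm hNh hNb hgm hgg hqm hqh hqre ho]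
  refine integral_congr_ae (Eventually.of_forall fun z => ?_)
  simp only
  ring

end Shape

/-! ## §3 END face: NE5 with BOTH species produced from the ONE shape -/

section End

variable {C : Carriers} {Op Hist : Type*} [NormedAddCommGroup Op] [NormedSpace ℂ Op] [NormedAddCommGroup Hist]
  [NormedSpace ℂ Hist] {ι : Type*} (M : StepModel C Op Hist) (T : ℕ → ι → Op → Hist → C.Dom → ℂ)
  {β : ℕ → ι → Type*} [∀ k i, MeasurableSpace (β k i)]
  {αO : ℕ → ι → Type*} [∀ k i, NormedAddCommGroup (αO k i)] [∀ k i, InnerProductSpace ℝ (αO k i)]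
  [∀ k i, FiniteDimensional ℝ (αO k i)] [∀ k i, MeasurableSpace (αO k i)] [∀ k i, BorelSpace (αO k i)]

/-- **NE5 FROM BUDGET, TERMWISE DATA AND THE ONE (2.14)-SHAPE FOR BOTH SPECIES** —
`OutputRateOpHolomorphic.ne5_at_of_stepModel_termwise_biStructural_budget_scale_nat` with BOTH structural binders PRODUCED from
`TermGaussianParamBi` (room `ROp k < R′ k`): `hball := termOpHolomorphicBall_of_gaussianParam (termOpGaussianParam_of_bi hBi)`,
`hexp := termHistExpLinear_of_bi hroom hBi`; every other binder BY NAME and unchanged; SAME smallness `ω + G·c/(1 − ρ₀) < θ′`, SAME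
constant; conclusion `T4OutputRate.NE5` LITERALLY.  NOT a proof of NE5 for Bałaban's step: the dictionary `TermGaussianParamBi` for the
model of record is the swarm's O1-d2-ii; W1/W3/W4/MI-R/levels/R/S displayed as before. [folklore] -/
theorem ne5_at_of_stepModel_termwise_gaussianParamBi_budget_scale_nat {EA : Functional C C.BgA} {EB : Functional C C.BgB}
    {W : Set (ℕ → ℝ)} {ctr : ℕ → (ℕ → ℝ) → C.BgB → Op × Hist} {BOp BHist ROp RHist R' : ℕ → ℝ} {a : ℕ → ι → ℝ}
    {lam : ∀ k i, C.Dom → Measure (β k i)} {w : ∀ k i, C.Dom → β k i → ℂ} {N : ∀ k i, C.Dom → Op → β k i → ℂ}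
    {F₀ : ∀ k i, C.Dom → β k i → αO k i → ℂ} {Λ : ∀ k i, C.Dom → β k i → αO k i → (Hist →L[ℂ] ℂ)}
    {q : ∀ k i, C.Dom → Op → β k i → αO k i → ℂ} {m b w₀ N₀ F N₁ : ℕ → ι → C.Dom → ℝ}
    {κ G EA₀ E₀ E₁ δ δ' θ θ' c ω ρ₀ B : ℝ} {k₀ : ℕ}
    (hrA : M.RepresentsA EA W) (hrB : M.RepresentsB EB W) (hbase : M.InBase EB W) (hbudget : BaseBudget M W ctr BOp BHist)
    (hOp : ∀ k, BOp k + M.rOp k ≤ ROp k) (hHist : ∀ k, BHist k + M.rHist k ≤ RHist k)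
    (hrep : TermRep M (ballClass ctr ROp RHist) T W) (hbd : TermBound (ballClass ctr ROp RHist) T W κ a)
    (hbud : TermBudget a G) (hroom : ∀ k, ROp k < R' k)
    (hBi : TermGaussianParamBi T W ctr RHist R' lam w N F₀ Λ q m b w₀ N₀ F N₁)
    (hdA : DecayBound EA W EA₀ κ) (hdB : DecayBound EB W E₀ κ) (hop : M.OperatorRate W δ θ)
    (hins : M.InsertionRate W κ E₀ δ' θ) (haff : M.InsAffine W) (hblind : M.InsBlind W) (hhom : M.InsHomog W)
    (hunit : M.InsScaleBound W κ E₁ c ω) (hE₁ : 0 < E₁) (hG0 : 0 ≤ G) (hδ : 0 ≤ δ) (hδ' : 0 ≤ δ') (hθ : 0 ≤ θ)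
    (hθθ' : θ ≤ θ') (hθ'1 : θ' ≤ 1) (hc : 0 ≤ c) (hω : 0 < ω) (hρ₀ : ρ₀ < 1)
    (hnear : (δ + δ') * θ ^ k₀ + c * (EA₀ + E₀) / (1 - ω) ≤ ρ₀) (hB : 0 ≤ B) (hfirst : ∀ k < k₀, EA₀ + E₀ ≤ B * θ ^ k)
    (hsmall : ω + G / (1 - ρ₀) * c < θ') :
    NE5 EA EB W κ θ' ((G / (1 - ρ₀) * δ + G / (1 - ρ₀) * δ' + B) * (θ' - ω) / (θ' - (ω + G / (1 - ρ₀) * c))) := by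
  have hball := termOpHolomorphicBall_of_gaussianParam (termOpGaussianParam_of_bi hBi)
  have hexp := termHistExpLinear_of_bi hroom hBi
  exact ne5_at_of_stepModel_termwise_biStructural_budget_scale_nat M T hrA hrB hbase hbudget hOp hHist hrep hbd hbud hroom
    hball hexp hdA hdB hop hins haff hblind hhom hunit hE₁ hG0 hδ hδ' hθ hθθ' hθ'1 hc hω hρ₀ hnear hB hfirst hsmall

end End

end Summit.QuantumFields.BalabanUV.T4Continuum.OutputRateGaussianParamBi

end
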